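import Literature.AnabelianGeometry.AbsoluteAnabelian.AbsTopIII.GeometricCyclotome
import HarnessLib

/-!
# [AbsTopIII] Prop. 1.4 (ii) / Prop. 1.6 / Thm. 1.9 (b)–(d): `M_X` as a topological `Π_X`-module and `H¹(Π_U, M_X)`

Mochizuki, *Topics in Absolute Anabelian Geometry III*, §1 (manuscript pages, lit key
`paper:url-5493eb38cbb7`): Prop. 1.4 (ii) p. 31 (`M_X := Hom(H²(Δ_X, Ẑ), Ẑ)`), Prop. 1.6 p. 34
("`κ_U : Γ(U, 𝒪_U^×) → H¹(Π_U, M_X)`"), Thm. 1.9 (b)–(d) p. 37 ("`I_z ⥲ μ_Ẑ(Π_U) := M_Z`",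
"`P_U ⊆ H¹(Π_U, μ_Ẑ(Π_U))`", "`lim_V H¹(Π_V, μ_Ẑ(Π_U))`"), Cor. 1.10 (ii)(d) p. 42
("`H¹(Π_X, μ_Ẑ(Π_X))`").

`GeometricCyclotome.lean` made the INTRINSIC cyclotome `M_X(Λ) = Hom(H²(Δ_X, Λ), Λ)` real, together
with the maps `H²(c_g)` induced by conjugation by `g ∈ Π_X`, leaving the action axioms as debt.  This
file discharges that debt and turns `M_X(Λ)` into a Mathlib topological representation of `Π_X`, so
that the cohomology groups of §1 with INTRINSIC coefficients become real objects:

* `geomH2Map_one`, `geomH2Map_mul` — `H²(c_1) = id`, `H²(c_{gh}) = H²(c_h) ∘ H²(c_g)` (from Mathlib's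
  `ContinuousCohomology.map_id / map_comp` through a congruence lemma for the dependent types);
* `CyclotomeMod E Λ` — the type `M_X(Λ)` with the topology of pointwise convergence (a topological
  `ℤ`-module); `cyclotomeModRep E Λ : ContRepresentation ℤ Π_X (CyclotomeMod E Λ)` — the action
  `g·m = m ∘ H²(c_g)` (PROVED to be a monoid action by continuous linear maps);
* `cyclotomeModH1 r` — **`H¹(Π_U, M_X(Λ))`** for a homomorphism of extensions `r : Π_U → Π_X`
  (Mathlib `continuousCohomology 1` of the restricted representation) and `cyclotomeModH1Res r D` —
  restriction to a closed subgroup `D ≤ Π_U` ("restricting cohomology classes of `Π_U` to the various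
  `I_x`", Prop. 1.6 (iii) p. 35; "`η|_x := s_x^*(η)`", Prop. 1.8 (i) p. 36).

Not here: the synchronizations `I_z ⥲ M_X` (Thm. 1.9 (b); typed as a fact in the next file), the Kummer
map itself (geometric), `P_U`.
-/

noncomputable section

open CategoryTheory

universe u

namespace Literature.AnabelianGeometry.AbsoluteAnabelian.AbsTopIII

/-! ### The action axioms for `H²(c_g)` -/

section ActionAxioms

variable (E : FundamentalExtension.{u}) (Λ : Type u) [AddCommGroup Λ] [TopologicalSpace Λ]
  [IsTopologicalAddGroup Λ]

/-- Congruence for `ContinuousCohomology.map` in the (dependently typed) pair `(φ, f)`: equal group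
homomorphisms and morphisms with equal underlying continuous linear maps induce the same map on
cohomology (bookkeeping). [cite: MochizukiAbsTopIII2015, Prop 1.4 (ii) p.31] -/
theorem contCohomologyMap_congr {k : Type} [Ring k] [TopologicalSpace k] {G H : Type u} [Group G]
    [TopologicalSpace G] [IsTopologicalGroup G] [Group H] [TopologicalSpace H] [IsTopologicalGroup H]
    {X : TopRep.{u} k G} {Y : TopRep.{u} k H}
    {φ φ' : H →ₜ* G} (hφ : φ = φ') (f : TopRep.res (φ : H →* G) X ⟶ Y)
    (f' : TopRep.res (φ' : H →* G) X ⟶ Y)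
    (hf : f.hom.toContinuousLinearMap = f'.hom.toContinuousLinearMap) (n : ℕ) :
    ContinuousCohomology.map φ f n = ContinuousCohomology.map φ' f' n := by
  subst hφ
  obtain rfl : f = f' := TopRep.hom_ext (ContIntertwiningMap.ext hf)
  rfl

/-- `c_1 = id` on `Δ`. [cite: MochizukiAbsTopIII2015, Prop 1.4 (ii) p.31] -/
theorem geomConj_one : geomConj E 1 = ContinuousMonoidHom.id E.geom := by
  ext x
  simp

/-- `c_{gh} = c_g ∘ c_h` on `Δ`. [cite: MochizukiAbsTopIII2015, Prop 1.4 (ii) p.31] -/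
theorem geomConj_mul (g h : E.arith) :
    geomConj E (g * h) = (geomConj E g).comp (geomConj E h) := by
  ext x
  simp [mul_assoc]

/-- `H²(c_1) = id`. [cite: MochizukiAbsTopIII2015, Prop 1.4 (ii) p.31] -/
theorem geomH2Map_one : geomH2Map E Λ 1 = 𝟙 (geomH2 E Λ) := by
  unfold geomH2Map
  rw [contCohomologyMap_congr (geomConj_one E) (geomTrivialResHom E Λ 1) (𝟙 (geomTrivialRep E Λ))
    rfl 2]
  exact ContinuousCohomology.map_id _ 2

/-- `H²(c_{gh}) = H²(c_h) ∘ H²(c_g)` (contravariance of cohomology in the group).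
[cite: MochizukiAbsTopIII2015, Prop 1.4 (ii) p.31] -/
theorem geomH2Map_mul (g h : E.arith) :
    geomH2Map E Λ (g * h) = geomH2Map E Λ g ≫ geomH2Map E Λ h := by
  unfold geomH2Map
  rw [contCohomologyMap_congr (geomConj_mul E g h) (geomTrivialResHom E Λ (g * h))
    ((TopRep.resFunctor (geomConj E h : E.geom →* E.geom)).map (geomTrivialResHom E Λ g) ≫
      geomTrivialResHom E Λ h) rfl 2]
  exact ContinuousCohomology.map_comp _ _ _ _ 2

/-- On `M_X(Λ)`: `1 · m = m`. [cite: MochizukiAbsTopIII2015, Prop 1.4 (ii) p.31] -/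
theorem geomCyclotomeDualMap_one (m : geomCyclotomeDual E Λ) : geomCyclotomeDualMap E Λ 1 m = m := by
  ext ξ
  rw [geomCyclotomeDualMap_apply, geomH2Map_one]
  rfl

/-- On `M_X(Λ)`: `(gh) · m = g · (h · m)`. [cite: MochizukiAbsTopIII2015, Prop 1.4 (ii) p.31] -/
theorem geomCyclotomeDualMap_mul (g h : E.arith) (m : geomCyclotomeDual E Λ) :
    geomCyclotomeDualMap E Λ (g * h) m =
      geomCyclotomeDualMap E Λ g (geomCyclotomeDualMap E Λ h m) := by
  ext ξ
  rw [geomCyclotomeDualMap_apply, geomCyclotomeDualMap_apply, geomCyclotomeDualMap_apply,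
    geomH2Map_mul]
  rfl

end ActionAxioms

/-! ### `M_X(Λ)` as a topological `Π_X`-module -/

section Module

variable (E : FundamentalExtension.{u}) (Λ : Type u) [AddCommGroup Λ] [TopologicalSpace Λ]
  [IsTopologicalAddGroup Λ]

/-- `M_X(Λ) = Hom(H²(Δ_X, Λ), Λ)` as a TYPE OF ITS OWN (so that it can carry a topology): the same
`ℤ`-module as `geomCyclotomeDual E Λ`. [cite: MochizukiAbsTopIII2015, Prop 1.4 (ii) p.31] -/
def CyclotomeMod : Type u := geomCyclotomeDual E Λ

/-- `M_X(Λ)` is an abelian group. [cite: MochizukiAbsTopIII2015, Prop 1.4 (ii) p.31] -/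
instance CyclotomeMod.instAddCommGroup : AddCommGroup (CyclotomeMod E Λ) :=
  inferInstanceAs (AddCommGroup (geomCyclotomeDual E Λ))

variable {E Λ} in
/-- The identification with `geomCyclotomeDual` (identity). [cite: MochizukiAbsTopIII2015, Prop 1.4 (ii) p.31] -/
def CyclotomeMod.toDual (m : CyclotomeMod E Λ) : geomCyclotomeDual E Λ := m

variable {E Λ} in
/-- The identification with `geomCyclotomeDual` (identity). [cite: MochizukiAbsTopIII2015, Prop 1.4 (ii) p.31] -/
def CyclotomeMod.ofDual (m : geomCyclotomeDual E Λ) : CyclotomeMod E Λ := m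

/-- Evaluation `M_X(Λ) → (H²(Δ_X, Λ) → Λ)` as an additive homomorphism (used to induce the topology).
[cite: MochizukiAbsTopIII2015, Prop 1.4 (ii) p.31] -/
def CyclotomeMod.evalHom : CyclotomeMod E Λ →+ (geomH2 E Λ → Λ) where
  toFun m := fun ξ => m.toDual ξ
  map_zero' := rfl
  map_add' _ _ := rfl

/-- The topology of pointwise convergence on `M_X(Λ) ⊆ Λ^{H²(Δ_X, Λ)}` (for `Λ = Ẑ` and
`H²(Δ_X, Ẑ) ≅ Ẑ` this is the profinite topology of `M_X ≅ Ẑ`). [cite: MochizukiAbsTopIII2015, Prop 1.4 (ii) p.31] -/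
instance CyclotomeMod.instTopologicalSpace : TopologicalSpace (CyclotomeMod E Λ) :=
  TopologicalSpace.induced (CyclotomeMod.evalHom E Λ) inferInstance

/-- `M_X(Λ)` is a topological abelian group. [cite: MochizukiAbsTopIII2015, Prop 1.4 (ii) p.31] -/
instance CyclotomeMod.instIsTopologicalAddGroup : IsTopologicalAddGroup (CyclotomeMod E Λ) :=
  Topology.IsInducing.topologicalAddGroup (CyclotomeMod.evalHom E Λ) ⟨rfl⟩

variable {E Λ} in
/-- Evaluation at a class `ξ ∈ H²(Δ_X, Λ)` is continuous. [cite: MochizukiAbsTopIII2015, Prop 1.4 (ii) p.31] -/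
theorem CyclotomeMod.continuous_eval (ξ : geomH2 E Λ) :
    Continuous fun m : CyclotomeMod E Λ => m.toDual ξ :=
  (continuous_apply ξ).comp continuous_induced_dom

/-- The action of `g ∈ Π_X` on `M_X(Λ)`, `m ↦ m ∘ H²(c_g)`, as a continuous `ℤ`-linear map.
[cite: MochizukiAbsTopIII2015, Prop 1.4 (ii) p.31] -/
def CyclotomeMod.act (g : E.arith) : CyclotomeMod E Λ →L[ℤ] CyclotomeMod E Λ where
  toFun m := CyclotomeMod.ofDual (geomCyclotomeDualMap E Λ g m.toDual)
  map_add' m m' := map_add (geomCyclotomeDualMap E Λ g) m.toDual m'.toDual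
  map_smul' c m := by
    change geomCyclotomeDualMap E Λ g (c • m.toDual) = c • geomCyclotomeDualMap E Λ g m.toDual
    exact map_zsmul _ c _
  cont := by
    refine continuous_induced_rng.2 (continuous_pi fun ξ => ?_)
    exact CyclotomeMod.continuous_eval ((geomH2Map E Λ g).hom ξ)

/-- Formula for the action. [cite: MochizukiAbsTopIII2015, Prop 1.4 (ii) p.31] -/
@[simp] theorem CyclotomeMod.toDual_act (g : E.arith) (m : CyclotomeMod E Λ) :
    (CyclotomeMod.act E Λ g m).toDual = geomCyclotomeDualMap E Λ g m.toDual :=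
  rfl

/-- **`M_X(Λ)` as a continuous representation of `Π_X`** over `ℤ` ("a `Π_X`-module `μ_Ẑ(Π_X)` as in
Proposition 1.4, (ii)", Cor. 1.10 (ii) p. 42): `g ↦ (m ↦ m ∘ H²(c_g))`, a monoid homomorphism into the
continuous linear endomorphisms by `geomH2Map_one/mul`. [cite: MochizukiAbsTopIII2015, Cor 1.10 (ii) p.42] -/
def cyclotomeModRep : ContRepresentation ℤ E.arith (CyclotomeMod E Λ) :=
  .ofMonoidHom
    { toFun := CyclotomeMod.act E Λ
      map_one' := by
        ext m
        exact geomCyclotomeDualMap_one E Λ m.toDual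
      map_mul' := fun g h => by
        ext m
        exact geomCyclotomeDualMap_mul E Λ g h m.toDual }

/-- `M_X(Λ)` in Mathlib's category `TopRep ℤ Π_X`. [cite: MochizukiAbsTopIII2015, Cor 1.10 (ii) p.42] -/
abbrev cyclotomeModTopRep : TopRep.{u} ℤ E.arith := TopRep.of (cyclotomeModRep E Λ)

end Module

/-! ### `H¹(Π_U, M_X(Λ))` and restriction to subgroups -/

section H1

variable {E' E : FundamentalExtension.{u}} (r : E' ⟶ E) (Λ : Type u) [AddCommGroup Λ]
  [TopologicalSpace Λ] [IsTopologicalAddGroup Λ]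

/-- **`H¹(Π_U, M_X(Λ))`** for a homomorphism of extensions `r : Π_U → Π_X` (e.g. `U ⊆ X` a cofinite
open of the proper curve `X`, `μ_Ẑ(Π_U) := M_X`, Thm. 1.9 (b)–(d) p. 37; `r = 𝟙` gives
"`H¹(Π_X, μ_Ẑ(Π_X))`" of Cor. 1.10 (ii)(d) p. 42): Mathlib's continuous cohomology in degree `1` of the
restriction of `cyclotomeModTopRep` along `r` — a topological `ℤ`-module (REAL, intrinsic
coefficients). [cite: MochizukiAbsTopIII2015, Thm 1.9 (d) p.37] -/
abbrev cyclotomeModH1 : TopModuleCat.{u} ℤ :=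
  continuousCohomology.{0, u, u} 1
    (TopRep.res (r.arith : E'.arith →* E.arith) (cyclotomeModTopRep E Λ))

/-- Restriction `H¹(Π_U, M_X(Λ)) → H¹(D, M_X(Λ))` to a subgroup `D ≤ Π_U` — "restricting cohomology
classes of `Π_U` to the various `I_x`" (Prop. 1.6 (iii) p. 35), "`η|_{x} := s_x^*(η)`" for a
decomposition group (Prop. 1.8 (i) p. 36). [cite: MochizukiAbsTopIII2015, Prop 1.6 (iii) p.35] -/
def cyclotomeModH1Res (D : Subgroup E'.arith) :
    cyclotomeModH1 r Λ ⟶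
      continuousCohomology.{0, u, u} 1
        (TopRep.res (subgroupInclusion D : D →* E'.arith)
          (TopRep.res (r.arith : E'.arith →* E.arith) (cyclotomeModTopRep E Λ))) :=
  ContinuousCohomology.map.{0, u, u} (subgroupInclusion D) (𝟙 _) 1

end H1

end Literature.AnabelianGeometry.AbsoluteAnabelian.AbsTopIII
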